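import Summits.AtomisticToContinuum.HydrodynamicLimit.Theses.TwoClocks
import Summits.AtomisticToContinuum.HydrodynamicLimit.Theses.OneFlightGossipEngine
import Summits.AtomisticToContinuum.HydrodynamicLimit.Theses.UGibbsSRBRigidity
import Summits.AtomisticToContinuum.HydrodynamicLimit.Theorems.ImplosionDichotomyHydroLimitInBandOfHeart
import Summits.AtomisticToContinuum.HydrodynamicLimit.Theorems.OneFlightGossipEngineClampedTransferDockOfInputs
import Summits.AtomisticToContinuum.HydrodynamicLimit.Theorems.OneFlightGossipEngineClampedTransferDockSeet
import Summits.AtomisticToContinuum.HydrodynamicLimit.Theorems.TwoClocksTransferEntropyClockFamilyNodesReduction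
import Summits.AtomisticToContinuum.HydrodynamicLimit.Theorems.TwoClocksTransferEntropyClockWindowUpgrade
import Summits.AtomisticToContinuum.HydrodynamicLimit.Theorems.TwoClocksTransferEntropyClockEquilibriumFamily
import Summits.AtomisticToContinuum.HydrodynamicLimit.Theorems.OneFlightGossipEngineAssembly
import HarnessLib

/-!
# The clock of route TwoClocks over the rate-dock children as EXISTING ITEMS (line `Sketch` v10 / SPLIT-REQUEST v2 Option A; crux stmt-AtomisticToContinuum-16625; support file)

Kernel-checked records for the planner's restate/split of crux 16625
(`TwoClocks.TransferEntropyClock = KineticWindowLDUniform → ClampedTransferWindowLD → TransferActivityTails → EnergyCurrentTails →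
DiluteSelfConsistency → _root_.HydrodynamicLimit`), companions of `TwoClocksTransferEntropyClockRestatedBand.lean` (p142073, variant B)
written directly over crux 17615's LANDED conditional closing `ClampedTransferDockSketch.clampedTransferDock_of_inputs_transfer` (p140743)
and the landed `ClampedTransferDockSeet.seet_imp_energyCurrentTails` (SEET ⇒ ECT), so that `EnergyCurrentTails` is discharged:

* `seet_of_gaussianTails : UGibbsSRBRigidity.GaussianTails → SuperExponentialEnergyTails` — the guarded variant of the landed
  `ClampedTransferDockSeet.seet_of_highMomentumCutoff`: item stmt-14415 (Nachtergaele–Yau Assumption II.1 along the true evolution, guarded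
  by the Euler horizon) implies 17615's SEET (same pointwise lemma `lintegral_cubicTail_le_of_expMoment`; `N₀` from 14415);
* `hydrodynamicLimit_of_oneFlightItems` — the Statement from the four route ITEMS of OneFlightGossipEngine rev 32 (stmt-16659
  `KineticCurrentsLDAlongFamilies`, stmt-17691 `LocalClampedTransferLDAlongFamilies`, stmt-17701 `SuperExponentialEnergyTails`, stmt-17700
  `BandCoherenceLDAlongFamilies`; byte-identical with the heart's / the cubic-rate file's defs) and `TwoClocks.TransferActivityTails`
  (stmt-16624): the type a RESTATE of crux 16625 over existing items would take;
* `hydrodynamicLimit_of_rateNodes` — the same with the tail child typed as item stmt-14415 `UGibbsSRBRigidity.GaussianTails`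
  (SPLIT-REQUEST v2 Option A, child 3);
* `transferEntropyClock_of_oneFlightItems`, `transferEntropyClock_of_rateNodes` — the crux BY NAME from those children (the `--glue-by`
  theorems of the corresponding splits; `KineticWindowLDUniform`, `ClampedTransferWindowLD`, `EnergyCurrentTails`, `DiluteSelfConsistency`
  idle, `TransferActivityTails` consumed), and `transferEntropyClock_of_rateNodes_S3b` keeping KWLDU consumed through the landed S3x window
  upgrade + S3a equilibrium-family theorem and an S3b-typed localisation child.
Lead prover-line-stmt-AtomisticToContinuum-16625-c5-0, cycle 3.
-/

noncomputable section

open MeasureTheory Set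
open scoped ENNReal

namespace Summit.AtomisticToContinuum.HydrodynamicLimit.Theorems.TransferEntropyClockRateNodes

open Literature.MathematicalPhysics.KineticTheory Literature.Analysis.FluidPDE
open Summit.AtomisticToContinuum.HydrodynamicLimit.Theses
open Summit.AtomisticToContinuum.HydrodynamicLimit.Theorems.HydroLimitInBandOfHeart
  (LocalClampedTransferWindowLDFamily KineticCurrentsWindowLDFamily)
open Summit.AtomisticToContinuum.HydrodynamicLimit.Theorems.TransferEntropyClockFrame
  (EquilibriumKineticLDFamily stub_equilibriumFamily)
open Summit.AtomisticToContinuum.HydrodynamicLimit.Theorems.ClampedTransferDockCubicRate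
  (SuperExponentialEnergyTails BandCoherenceLDFamily)
open Summit.AtomisticToContinuum.HydrodynamicLimit.Theorems.ClampedTransferDockSeet
  (lintegral_cubicTail_le_of_expMoment seet_imp_energyCurrentTails)
open Summit.AtomisticToContinuum.HydrodynamicLimit.Theorems.ClampedTransferDockSketch
  (clampedTransferDock_of_inputs_transfer)
open Summit.AtomisticToContinuum.HydrodynamicLimit.Theorems.TransferEntropyClockFamilyNodes
  (transferActivityTails_iff_dock)

/-! ## §1 Item 14415 implies SEET -/

/-- **Gaussian velocity tails along the true evolution (item stmt-14415, Nachtergaele–Yau Assumption II.1 guarded by the Euler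
horizon) imply the super-exponential energy tails SEET.** At `(t, c′)` item 14415 gives `c > 0`, `C < ∞`, `N₀` with
`∫ (N+1)⁻¹ ∑ᵢ exp(c ‖vᵢ(Φ_N(s) z)‖²) dλ^N ≤ C` for `N ≥ N₀`, `s ∈ [0, t]`; with `K₀ = max (max 1 (48/c³)) (max (2(c′+1)/c) (C+1))`
the landed pointwise estimate `lintegral_cubicTail_le_of_expMoment` bounds the cubic tail above `K ≥ K₀` by `e^{-c′K} ≤ e^{-c′K} + ε`.
[cite: NachtergaeleYau2003, §2.3 Assumption II.1 and §7.2] -/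
theorem seet_of_gaussianTails : UGibbsSRBRigidity.GaussianTails → SuperExponentialEnergyTails := by
  intro h a₀ θ₀ u₀ ha hθ hu ha0 hθ0
  obtain ⟨σ₀, hσ₀, H⟩ := h a₀ θ₀ u₀ ha hθ hu ha0 hθ0
  refine ⟨σ₀, hσ₀, fun σ hσ hσlt T ρ θ u hE Φ htie t ht c' hc' => ?_⟩
  obtain ⟨c, hc, C, hC, N₀, hb⟩ := H σ hσ hσlt T ρ θ u hE Φ htie t ht
  refine ⟨max (max 1 (48 / c ^ 3)) (max (2 * (c' + 1) / c) (C.toReal + 1)),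
    lt_of_lt_of_le one_pos ((le_max_left _ _).trans (le_max_left _ _)), fun K hK ε hε => ⟨N₀, fun N hN s hs => ?_⟩⟩
  exact (lintegral_cubicTail_le_of_expMoment (localGibbsLaw σ a₀ u₀ θ₀ N (Φ N)) ((Φ N).flow s) hc hc'
    (lt_top_iff_ne_top.mpr hC.ne) (hb N hN s hs) hK).trans (ENNReal.ofReal_le_ofReal (by linarith [hε.le]))

/-! ## §2 The Statement from the children, `EnergyCurrentTails` discharged by SEET -/

/-- **The Statement from the four nodes and the transfer-activity tails** (variant B without `EnergyCurrentTails`): crux 17615's landed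
conditional closing `clampedTransferDock_of_inputs_transfer` gives the dock `KineticCurrentsLDAlongFamilies → CollisionActivityTails →
EnergyCurrentTails → HydrodynamicLimit`; its binders are the kinetic family node (same term), CAT from the transfer-activity tails
(`HydroLimitInBandHeart.activityTails_of_transferActivityTails`) and ECT from SEET (`seet_imp_energyCurrentTails`). [cite: Yau1991, §2] -/
theorem hydrodynamicLimit_of_nodes_of_seet :
    KineticCurrentsWindowLDFamily → LocalClampedTransferWindowLDFamily → SuperExponentialEnergyTails →
      BandCoherenceLDFamily → TwoClocks.TransferActivityTails → _root_.HydrodynamicLimit :=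
  fun hK hL hS hB h₇ =>
    have h₇' : ClampedCurrentsDockTransferTails.TransferActivityTails := transferActivityTails_iff_dock.mp h₇
    clampedTransferDock_of_inputs_transfer hS hB hL h₇'
      (show OneFlightGossipEngine.KineticCurrentsLDAlongFamilies from hK)
      (HydroLimitInBandHeart.activityTails_of_transferActivityTails h₇').1
      (seet_imp_energyCurrentTails hS)

/-- **The Statement from four EXISTING route items of OneFlightGossipEngine (rev 32) and one of TwoClocks**: stmt-16659
`KineticCurrentsLDAlongFamilies`, stmt-17691 `LocalClampedTransferLDAlongFamilies`, stmt-17701 `SuperExponentialEnergyTails`,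
stmt-17700 `BandCoherenceLDAlongFamilies` (same terms as the heart's / the cubic-rate file's defs) and stmt-16624
`TwoClocks.TransferActivityTails` — the type a restate of crux 16625 over existing items would take. [cite: Yau1991, §2] -/
theorem hydrodynamicLimit_of_oneFlightItems :
    OneFlightGossipEngine.KineticCurrentsLDAlongFamilies → OneFlightGossipEngine.LocalClampedTransferLDAlongFamilies →
      OneFlightGossipEngine.SuperExponentialEnergyTails → OneFlightGossipEngine.BandCoherenceLDAlongFamilies →
        TwoClocks.TransferActivityTails → _root_.HydrodynamicLimit :=
  fun hK hL hS hB h₇ =>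
    hydrodynamicLimit_of_nodes_of_seet (show KineticCurrentsWindowLDFamily from hK)
      (show LocalClampedTransferWindowLDFamily from hL) (show SuperExponentialEnergyTails from hS)
      (show BandCoherenceLDFamily from hB) h₇

/-- **The Statement from the SPLIT-REQUEST v2 Option-A children** (tail child typed as item stmt-14415 `UGibbsSRBRigidity.GaussianTails`)
and the transfer-activity tails. [cite: Yau1991, §2] -/
theorem hydrodynamicLimit_of_rateNodes :
    OneFlightGossipEngine.KineticCurrentsLDAlongFamilies → LocalClampedTransferWindowLDFamily → UGibbsSRBRigidity.GaussianTails →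
      BandCoherenceLDFamily → TwoClocks.TransferActivityTails → _root_.HydrodynamicLimit :=
  fun hK hL hG hB h₇ =>
    hydrodynamicLimit_of_nodes_of_seet (show KineticCurrentsWindowLDFamily from hK) hL (seet_of_gaussianTails hG) hB h₇

/-! ## §3 The crux by name (the `--glue-by` theorems) -/

/-- **The crux by name from the OneFlightGossipEngine rev-32 items**: `KineticWindowLDUniform`, `ClampedTransferWindowLD` (implied by
stmt-17691), `EnergyCurrentTails` (implied by stmt-17701) and `DiluteSelfConsistency` are idle; `TransferActivityTails` is consumed.
[cite: Yau1991, §2] -/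
theorem transferEntropyClock_of_oneFlightItems :
    OneFlightGossipEngine.KineticCurrentsLDAlongFamilies → OneFlightGossipEngine.LocalClampedTransferLDAlongFamilies →
      OneFlightGossipEngine.SuperExponentialEnergyTails → OneFlightGossipEngine.BandCoherenceLDAlongFamilies →
        TwoClocks.TransferEntropyClock :=
  fun hK hL hS hB _ _ h₇ _ _ => hydrodynamicLimit_of_oneFlightItems hK hL hS hB h₇

/-- **The `--glue-by` theorem of SPLIT-REQUEST v2 Option A**: the crux by name from the kinetic family node (stmt-16659's decl), the
local clamped-transfer family node (= stmt-17691), the Gaussian tails item stmt-14415 and the band exponential moment (= stmt-17700).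
[cite: Yau1991, §2] -/
theorem transferEntropyClock_of_rateNodes :
    OneFlightGossipEngine.KineticCurrentsLDAlongFamilies → LocalClampedTransferWindowLDFamily → UGibbsSRBRigidity.GaussianTails →
      BandCoherenceLDFamily → TwoClocks.TransferEntropyClock :=
  fun hK hL hG hB _ _ h₇ _ _ => hydrodynamicLimit_of_rateNodes hK hL hG hB h₇

/-- **Option A with the kinetic child typed S3b-style** (localisation from the landed equilibrium family node), so that the crux's
first antecedent KWLDU stays consumed through the landed S3x window upgrade (`TransferEntropyClockWindows.stub_windowUpgrade`) and S3a
equilibrium-family theorem (`TransferEntropyClockFrame.stub_equilibriumFamily`). [cite: Yau1991, §2] -/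
theorem transferEntropyClock_of_rateNodes_S3b :
    (EquilibriumKineticLDFamily → KineticCurrentsWindowLDFamily) → LocalClampedTransferWindowLDFamily →
      UGibbsSRBRigidity.GaussianTails → BandCoherenceLDFamily → TwoClocks.TransferEntropyClock :=
  fun hS3b hL hG hB hKW _ h₇ _ _ =>
    hydrodynamicLimit_of_rateNodes
      (show OneFlightGossipEngine.KineticCurrentsLDAlongFamilies from
        hS3b (stub_equilibriumFamily
          (show TransferEntropyClockFrame.WindowUpgrade from TransferEntropyClockWindows.stub_windowUpgrade) hKW))
      hL hG hB h₇

end Summit.AtomisticToContinuum.HydrodynamicLimit.Theorems.TransferEntropyClockRateNodes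

end
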